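import Summits.KontsevichZagierPeriods.KontsevichZagierPeriods.Theorems.FermatIsogenyDeepWordSectorP04

/-! # `FermatIsogenyDeepWordSectorP05` — part 5/11 of the mechanical ≤400-line split of `DeepWordSector.lean` (sha256 5e8cd5c1c920648a…)
Source: decomp-kz lens-5 g22 DeepWordSector.lean v10 @5e8cd5c1 (the deep Beta-word sector node: bridge S ⟺ BetaWordTower ∧ WordSectorComplete, finite boxes, box ladder, shadow arithmetic, Chudnovsky levels; critic CLEARED g6-2/3/4/11/13/16/19); --supports stmt-KontsevichZagierPeriods-3898.
Split by census-1 g10 `gen/splitlean.py`: scopes re-opened with their `open`/`variable`/`set_option` context; mathematics and declaration order unchanged. -/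

namespace Summit.KontsevichZagierPeriods.FermatIsogeny.DeepTargets
open Literature.NumberTheory.Transcendental MeasureTheory
open Summit.KontsevichZagierPeriods.KontsevichZagierPeriods.Theses.FermatIsogeny (BetaLinearSector BetaProductSector FermatSectorComplete)

/-- **The finite boxes, unconditionally**: `BetaWordSector k ↔ ∀ N > 0, BetaWordSectorLevel k N`. -/
theorem betaWordSector_iff_levels' (k : ℕ) : BetaWordSector k ↔ ∀ N, 0 < N → BetaWordSectorLevel k N :=
  betaWordSector_iff_levels betaReflectionMove_holds betaTranslationMove_holds k

/-- Crux 3898 box by box, unconditionally: `BetaProductSector ↔ ∀ N > 0, BetaWordSectorLevel 2 N`. -/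
theorem betaProductSector_iff_levels' : BetaProductSector ↔ ∀ N, 0 < N → BetaWordSectorLevel 2 N :=
  betaProductSector_iff_levels betaReflectionMove_holds betaTranslationMove_holds

/-- Crux 3897 box by box, unconditionally: `BetaLinearSector ↔ ∀ N > 0, BetaWordSectorLevel 1 N`. -/
theorem betaLinearSector_iff_levels' : BetaLinearSector ↔ ∀ N, 0 < N → BetaWordSectorLevel 1 N :=
  betaLinearSector_iff_levels betaReflectionMove_holds betaTranslationMove_holds

/-- A single box follows from the sector: `BetaWordSector k → BetaWordSectorLevel k N` (`0 < N`). -/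
theorem betaWordSectorLevel_of_betaWordSector {k N : ℕ} (hN : 0 < N) (h : BetaWordSector k) :
    BetaWordSectorLevel k N :=
  (betaWordSector_iff_levels' k).1 h N hN

/-- **Summit ⟺ all finite boxes ∧ off-sector completeness**:
`KontsevichZagierPeriods ↔ (∀ k N, 0 < N → BetaWordSectorLevel k N) ∧ WordSectorComplete`. -/
theorem summit_iff_levels_and_wordSectorComplete :
    _root_.KontsevichZagierPeriods ↔ (∀ k N, 0 < N → BetaWordSectorLevel k N) ∧ WordSectorComplete :=
  summit_iff_betaWordTower_and_wordSectorComplete.trans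
    (and_congr_left' (forall_congr' fun k => betaWordSector_iff_levels' k))

/-! ## The first rung of the box ladder: every `(k, 1)` box holds

At level `N = 1` every exponent is `1`, both integrands are constant (`1` and `q`) on the unit cube of volume `1`, so the value
hypothesis forces `q = 1` and the two representations have equal domains and integrands agreeing on them — ONE «same data»
step of the calculus (`KZ.of_sub_of_mem_relations_of_eqOn`).  No period content; it certifies that the box family starts. -/

/-- Auxiliary step `lvl_one_sub_one`: lvl one sub one. [bookkeeping] -/
theorem lvl_one_sub_one {k : ℕ} (w : Fin k → Fin 1) (i : Fin k) : ((lvl 1 w i : ℚ) : ℝ) - 1 = 0 := by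
  simp [lvl, Fin.val_eq_zero]

/-- Auxiliary step `volume_cube_eq_one`: volume cube eq one. [bookkeeping] -/
theorem volume_cube_eq_one (k : ℕ) : volume {x : Fin k → ℝ | ∀ i, x i ∈ Set.Ioo (0:ℝ) 1} = 1 := by
  have hcube : {x : Fin k → ℝ | ∀ i, x i ∈ Set.Ioo (0:ℝ) 1} = Set.pi Set.univ (fun _ => Set.Ioo (0:ℝ) 1) := by
    ext x; simp
  rw [hcube, Real.volume_pi_Ioo]
  simp

/-- Auxiliary step `measurableSet_cube`: measurable Set cube. [bookkeeping] -/
theorem measurableSet_cube (k : ℕ) : MeasurableSet {x : Fin k → ℝ | ∀ i, x i ∈ Set.Ioo (0:ℝ) 1} := by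
  have hcube : {x : Fin k → ℝ | ∀ i, x i ∈ Set.Ioo (0:ℝ) 1} = Set.pi Set.univ (fun _ => Set.Ioo (0:ℝ) 1) := by
    ext x; simp
  rw [hcube]; exact MeasurableSet.univ_pi fun _ => measurableSet_Ioo

/-- Value of a representation on the open unit cube whose integrand is constant `c` there. [bookkeeping] -/
theorem value_of_eqOn_const {k : ℕ} (r : KZ.IntegralRep k) (c : ℝ)
    (hrd : r.domain = {x | ∀ i, x i ∈ Set.Ioo (0:ℝ) 1}) (h : Set.EqOn r.integrand (fun _ => c) r.domain) :
    r.value = c := by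
  show ∫ x in r.domain, r.integrand x = c
  rw [setIntegral_congr_fun (hrd ▸ measurableSet_cube k) h, setIntegral_const, hrd, measureReal_def,
    volume_cube_eq_one]
  simp

/-- **Every `(k, 1)` box holds.** -/
theorem betaWordSectorLevel_one (k : ℕ) : BetaWordSectorLevel k 1 := by
  intro u v u' v' q _hq r r' hrd hri hr'd hr'i hval
  have h1 : Set.EqOn r.integrand (fun _ => (1:ℝ)) r.domain := by
    intro x hx; rw [hri hx]; simp only [lvl_one_sub_one, Real.rpow_zero, mul_one, Finset.prod_const_one]
  have h1' : Set.EqOn r'.integrand (fun _ => q) r'.domain := by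
    intro x hx; rw [hr'i hx]; simp only [lvl_one_sub_one, Real.rpow_zero, mul_one, Finset.prod_const_one]
  have hq1 : q = 1 := by
    rw [value_of_eqOn_const r 1 hrd h1, value_of_eqOn_const r' q hr'd h1'] at hval; exact hval.symm
  have hdom : r'.domain = r.domain := hr'd.trans hrd.symm
  exact KZ.of_sub_of_mem_relations_of_eqOn hdom fun x hx => by
    rw [h1 hx, h1' (hdom ▸ hx), hq1]

/-- In particular the sector statements hold «at level 1»: with `betaWordSector_iff_levels'` the open content of
`BetaWordSector k` (hence of 3897, 3898) is `∀ N ≥ 2, BetaWordSectorLevel k N`. -/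
theorem betaWordSector_iff_levels_two_le (k : ℕ) : BetaWordSector k ↔ ∀ N, 2 ≤ N → BetaWordSectorLevel k N := by
  rw [betaWordSector_iff_levels']; refine ⟨fun h N hN => h N (by omega), fun h N hN => ?_⟩
  rcases Nat.lt_or_ge N 2 with hlt | hge
  · obtain rfl : N = 1 := by omega
    exact betaWordSectorLevel_one k
  · exact h N hge

end Summit.KontsevichZagierPeriods.FermatIsogeny.DeepTargets
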